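import Summits.QuantumFields.BalabanUV.Beta.FP.NestedStepLawTransportedDeadRows
import Summits.QuantumFields.BalabanUV.Beta.FP.CoarseFPDefect

/-!
# `BalabanUV.Beta.FP.NestedDeadRowsOrderTwo` — road «FP» for binder row D1, ROUTE T, presentation T-β: **THE ORDER-2 COARSE DEAD ROW `t2` OF THE (III′)
# LEVEL-0 DOOR (U21) AND THE TOP-CHART FADDEEV–POPOV 2-JET `uTop` OF THE COMPOSITE DOOR (#21) UNDER `hdead`, AS A DICHOTOMY ON THE SHAPE OF THE ORDER-2
# COARSE JET `D̄₂`** (memo `N2B-DESIGN.md` (31d) (β) «`t2` — leaf-06, `t1`'s twin»; TID § F l.93 «(β-dead) `t1 t2` … order 2 ○»; R-FP-56 (a)∕(b))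

WHY.  leaf-02's U21 `FP/NestedStepLawTorusTransportedRowsGradedLevelZeroSymULowClosedLamW2Q2` (p342577 ✓) displays, next to the order-2 covariance row
`c2 : Q₁₂ h h · [D₂ | D₁] + 2•(Q₁₁ h · W₁) + Q₁₀ · W₂ = [D̄₂ | 0]` (`D̄₂` free), the coarse dead row `t2 : τ₂ · (the same word) = 0`; given `c2`,
`t2 ⟺ τ₂ · D̄₂ = 0` (my `NestedStepLawTransportedDeadRows.t_of_covariance_letter`).  The shape of `D̄₂` is the dictionary's (leaf-02 g23's detector C2-DET,
Q-d1leaf02-g23-1, journal l.47643; an2 W-an2-g43-10 GO): on the coarse comb bonds it is expected tip-type, `D̄₂(a, t̄) = w₂(a)·[t̄ = a.1 + e_{a.2}]` with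
`w₂(a) = κ₁(a)·w̄(a)² + V(a)`, `w̄ = Q₁₀ h` the direction's LINEAR average (dead on the comb bonds by the door's `hdead` — the OWNER's #29 for the nested column)
and `V` an `h ⊗ h`-bilinear remainder (the average map's second jet `(Q₁₁ h)·h`, weight `κ₂`).  This file types the two consequences the `t2` ∕ `uTop` slots
need, WITHOUT choosing the shape (every shape hypothesis is displayed, ON THE COMB ONLY — off the comb the coarse jets are unconstrained, the comb rows do not
read them):
* §1 `torus_coarse_mul_tipJet_eq_zero` — the comb slice kills a tip-type jet whose weight is comb-dead (root-generic SITE `ρ`, so that U21's spelling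
  `ctr (d+1) Lc` and #21's `combF Lc M′ r′ = … (toSite r′) …` are both instances); `torus_coarse_mul_sqJet_eq_zero` — the (polarised) SQUARE LAW
  `κ(a)·w̄(a)·w̄′(a)·[tip]` is killed as soon as ONE of the two linear averages is comb-dead (`hdead`).
* §2 **`torus_t2_of_c2_of_average_dead`** — `t2` from `c2` + `hdead` + «`D̄₂` is `(κ·w̄² + V)·[tip]` on the comb» + «`V` comb-dead»; the square-law case
  **`torus_t2_of_c2_sq`** (`V` absent: `t2 ⟸ hdead` ALONE — the `κ₂ = 0` branch); the `fromCols`-free form `torus_coarse_mul_Db2_eq_zero`.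
* §3 **`torus_uTop_eq_sum_of_average_dead`** — the `κ₂ ≠ 0` branch PRICED at the composite door #21 (`uTop : secondVar (τ₂·D̄) (τ₂·D̄₁) (τ₂·D̄₂) = 0`,
  :177): with `D̄₁ = −c·w̄·[tip]` (p314580 ∕ leaf-02 C2 `torus_c1_tower`'s shape) and `D̄₂ = v·[tip]` on the comb, under `hdead` my g22
  `CoarseFPDefect.torus_uTop_eq_sum` collapses to ONE scalar: `uTop = Σ_{comb x, tip} v(a_x)∕σ` — so `uTop ⟺ Σ v(a_x) = 0` over the comb bonds pointing at
  their parameter (`torus_uTop_of_average_dead_of_sum_eq_zero`), strictly weaker than `t2`'s ENTRYWISE `v(a_x) = 0` (`…_of_dead`); the square-law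
  branch `torus_uTop_of_average_dead_sq` (`uTop ⟸ hdead` alone).  §3 is spelled with `Q₁₀ *ᵥ h` (C2's `D̄₁`), §1–§2 with U21's `Σ_b Q₁₀ a b·h b`.
* §4 **`torus_uT_of_average_dead_of_sum_eq_zero`** — the same at the NESTED Faddeev–Popov 2-jet socket `uT` (`CoarseFPExponential.torus_uT_of_dead`'s
  statement with the dead-jet rows replaced by the displayed shapes + `hdead` + the one comb sum; `NestedFPSplit.secondVar_nestedFP_eq_zero_of_blocks`) —
  the m = 1 door's (uLow, uTop) route for the `κ₂ ≠ 0` branch, typed NOT chosen.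
[folklore] finite-matrix bookkeeping BY NAME over my g18∕g21∕g22 letters (`NestedSliceDeadJets`, `NestedStepLawTransportedDeadRows`, `NestedFPSplit`,
`TorusCompositeSlice`, `CoarseFPDefect`) and
`TorusCombRows`; no `def`, no `def … : Prop`, nothing cited, 0 sorry.  NOT HERE: which shape `D̄₂` HAS (κ₁, κ₂ — the detector's ∕ an1–an2's word), the
order-2 covariance letter `c2` itself (leaf-02), whether `V` is comb-dead for the nested column (it is NOT implied by #29's KKT argument — displayed), any
re-cut of the m = 1 door to the `uTop` presentation (the OWNER's ∕ the door author's call, Q-leaf06-g24-1, journal l.47660).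

HONEST DEPENDENCY (page 1, mandatory): continuum YM on T⁴ ⇐ BetaPertH ∧ nine spine estimates (0/9 proved); BetaPertH ⇐ (D1) ∧ (D4) ∧ CAP+tail;
G-an2-4 gates asym, D1 and NE2/3/4.  HONEST FRAMING (cell contract, verbatim): «discharging `BetaPertH` makes Bałaban's UV stability UNCONDITIONAL —
a real constructive-QFT result; it is NOT the continuum limit and NOT the Clay problem.»  ABSOLUTE RULE (cell charter, verbatim): «No internally-minted
statement may enter as a cited fact. Every hypothesis is either kernel-proved in this package or a verbatim quotation of a PUBLISHED theorem with page
reference. The manuscript(s) under audit are NOT citable for their own disputed steps — they are the thing under adjudication; programme-internal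
(2001/route/tribunal) claims are never citable.»  0 estimates; 0∕4 row-D1 binders (hW, hR, D1Tel, D1Rep); NOT the dictionary, NOT (T-ID)∕(T-β)
complete, NOT SDF, NOT D1, NOT BetaPertH, NOT continuum, NOT Clay.  «not in print; our bookkeeping».
Provenance: D1 formalisation swarm LEAF PROVER 06, unit b2b-balaban-beta-d1-formalise-leaf-06 gen 24, 2026-08-22.  No existing file touched.
-/

noncomputable section

namespace Summit.QuantumFields.BalabanUV.Beta.FP.NestedDeadRowsOrderTwo

open Matrix Finset
open scoped BigOperators
open Literature.MathematicalPhysics.QuantumFieldTheory.Balaban1983to89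
open Literature.MathematicalPhysics.QuantumFieldTheory.Balaban1983to89.Beta
open AffineAveraging (Site box toSite unitVec)
open B6Lemma24Torus (pbox)
open OneStepResolventKernel (Fib)
open Summit.QuantumFields.BalabanUV.Beta.AxialDressingRooted (IsCombBondAt)
open Summit.QuantumFields.BalabanUV.Beta.D1BFx.LogDetSecondVariation (secondVar)
open Summit.QuantumFields.BalabanUV.Beta.FP.KernelPeriodisationFib (Idx)
open Summit.QuantumFields.BalabanUV.Beta.FP.TorusCombForest (axisOf baseOf tipOf)
open Summit.QuantumFields.BalabanUV.Beta.FP.TorusCombRows (Res combBondT combRowsT baseOf_mem_pbox combBondT_eq)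
open Summit.QuantumFields.BalabanUV.Beta.FP.TorusGaugeCovariance (tgrad tdelta)
open Summit.QuantumFields.BalabanUV.Beta.FP.NestedSliceDeadJets (combSliceId_mul_eq_zero_of_vanish_on_dead)
open Summit.QuantumFields.BalabanUV.Beta.FP.NestedStepLawTransportedDeadRows (t_of_covariance_letter)
open Summit.QuantumFields.BalabanUV.Beta.FP.TorusCompositeObjects (combF)
open Summit.QuantumFields.BalabanUV.Beta.FP.CoarseFPDefect (torus_uTop_eq_sum)
open Summit.QuantumFields.BalabanUV.Beta.FP.TorusCompositeSlice (det_combF_mul_smul_tgrad_res_ne_zero)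
open Summit.QuantumFields.BalabanUV.Beta.FP.NestedFPSplit (secondVar_nestedFP_eq_zero_of_blocks)
open Summit.QuantumFields.BalabanUV.Beta.GAN24.FineReadoutCauchyFrame (toSite_mem_range)

variable {d : ℕ}

/-! ## §1 The coarse comb slice kills tip-type jets with comb-dead weights; the square law -/

section Slice

variable (M' : Fin (d + 1) → ℕ) {Lc : ℕ} {ρ : Site (d + 1)}

/-- [folklore] **A TIP-TYPE COARSE JET WHOSE WEIGHT IS COMB-DEAD IS KILLED BY THE COARSE COMB SLICE**: for `D(a, t̄) = u(a)·[t̄ = a.1 + e_{a.2}]` and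
`u(a) = 0` at every coarse comb bond `a` (`combBondT ρ Lc M′ x = (a.1, inl a.2)` — the door's `hdead` spelling), `τ₂ · D = 0` (`τ₂` in the door's
spelling; root-generic site `ρ`: U21 takes `ρ := ctr (d+1) Lc`, #21 `ρ := toSite (rs 0)`). -/
theorem torus_coarse_mul_tipJet_eq_zero {τ₂ : Matrix (Res ρ Lc M') (↥(pbox M') × Fin (d + 1)) ℝ}
    (hτ₂ : τ₂ = (combRowsT ρ Lc M').submatrix id (fun b : ↥(pbox M') × Fin (d + 1) => ((b.1, Sum.inl b.2) : Idx M' (Fib d))))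
    (u : ↥(pbox M') × Fin (d + 1) → ℝ)
    (hu : ∀ (a : ↥(pbox M') × Fin (d + 1)) (x : Res ρ Lc M'), combBondT ρ Lc M' x = ((a.1, Sum.inl a.2) : Idx M' (Fib d)) → u a = 0) :
    τ₂ * (Matrix.of fun (a : ↥(pbox M') × Fin (d + 1)) (t : Res ρ Lc M') => u a * tdelta M' ((a.1 : Site (d + 1)) + unitVec a.2) t.1) = 0 := by
  rw [hτ₂]
  refine combSliceId_mul_eq_zero_of_vanish_on_dead _ fun a x hx => ?_
  funext t
  rw [Matrix.of_apply, hu a x hx, zero_mul, Pi.zero_apply]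

/-- [folklore] **THE (POLARISED) SQUARE LAW IS KILLED BY `hdead`**: the tip-type jet with weight `κ(a)·w̄(a)·w̄′(a)`, `w̄ = Q₁₀ h`, `w̄′ = Q₁₀ h′`, dies under
the coarse comb slice as soon as ONE direction's linear average is comb-dead (`hdead` for `h`; ANY `Q₁₀`, ANY fine index type). -/
theorem torus_coarse_mul_sqJet_eq_zero {τ₂ : Matrix (Res ρ Lc M') (↥(pbox M') × Fin (d + 1)) ℝ}
    (hτ₂ : τ₂ = (combRowsT ρ Lc M').submatrix id (fun b : ↥(pbox M') × Fin (d + 1) => ((b.1, Sum.inl b.2) : Idx M' (Fib d))))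
    {ν : Type*} [Fintype ν] (Q₁₀ : Matrix (↥(pbox M') × Fin (d + 1)) ν ℝ) (h h' : ν → ℝ) (κ : ↥(pbox M') × Fin (d + 1) → ℝ)
    (hdead : ∀ (a : ↥(pbox M') × Fin (d + 1)) (x : Res ρ Lc M'),
      combBondT ρ Lc M' x = ((a.1, Sum.inl a.2) : Idx M' (Fib d)) → ∑ b, Q₁₀ a b * h b = 0) :
    τ₂ * (Matrix.of fun (a : ↥(pbox M') × Fin (d + 1)) (t : Res ρ Lc M') =>
        κ a * (∑ b, Q₁₀ a b * h b) * (∑ b, Q₁₀ a b * h' b) * tdelta M' ((a.1 : Site (d + 1)) + unitVec a.2) t.1) = 0 :=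
  torus_coarse_mul_tipJet_eq_zero M' hτ₂ _ fun a x hx => by rw [hdead a x hx, mul_zero, zero_mul]

/-- [folklore] **THE ORDER-2 COARSE JET OF SHAPE «square law + remainder» DIES UNDER `hdead` + «remainder comb-dead»**: for a coarse matrix `D̄₂` which ON
EVERY COMB BOND is tip-type with weight `κ(a)·w̄(a)² + V(a)` (`w̄ = Q₁₀ h`; off the comb unconstrained), `hdead` and `V(a) = 0` on the comb bonds give
`τ₂ · D̄₂ = 0`.  (`V ≡ 0`: the square-law case; `κ ≡ 0`: the pure-remainder case.) -/
theorem torus_coarse_mul_Db2_eq_zero {τ₂ : Matrix (Res ρ Lc M') (↥(pbox M') × Fin (d + 1)) ℝ}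
    (hτ₂ : τ₂ = (combRowsT ρ Lc M').submatrix id (fun b : ↥(pbox M') × Fin (d + 1) => ((b.1, Sum.inl b.2) : Idx M' (Fib d))))
    {ν : Type*} [Fintype ν] (Q₁₀ : Matrix (↥(pbox M') × Fin (d + 1)) ν ℝ) (h : ν → ℝ) (κ V : ↥(pbox M') × Fin (d + 1) → ℝ)
    (Db₂ : Matrix (↥(pbox M') × Fin (d + 1)) (Res ρ Lc M') ℝ)
    (hDb₂ : ∀ (a : ↥(pbox M') × Fin (d + 1)) (x : Res ρ Lc M'), combBondT ρ Lc M' x = ((a.1, Sum.inl a.2) : Idx M' (Fib d)) →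
      ∀ t : Res ρ Lc M', Db₂ a t = (κ a * (∑ b, Q₁₀ a b * h b) ^ 2 + V a) * tdelta M' ((a.1 : Site (d + 1)) + unitVec a.2) t.1)
    (hdead : ∀ (a : ↥(pbox M') × Fin (d + 1)) (x : Res ρ Lc M'),
      combBondT ρ Lc M' x = ((a.1, Sum.inl a.2) : Idx M' (Fib d)) → ∑ b, Q₁₀ a b * h b = 0)
    (hV : ∀ (a : ↥(pbox M') × Fin (d + 1)) (x : Res ρ Lc M'), combBondT ρ Lc M' x = ((a.1, Sum.inl a.2) : Idx M' (Fib d)) → V a = 0) :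
    τ₂ * Db₂ = 0 := by
  rw [hτ₂]
  refine combSliceId_mul_eq_zero_of_vanish_on_dead _ fun a x hx => ?_
  funext t
  rw [hDb₂ a x hx t, hdead a x hx, hV a x hx, Pi.zero_apply]
  ring

end Slice

/-! ## §2 `t2` of the (III′) level-0 door from `c2`, `hdead` and the displayed shape of `D̄₂` -/

section T2

variable (M' : Fin (d + 1) → ℕ) {Lc : ℕ} {ρ : Site (d + 1)}

/-- [folklore] **`torus_t2_of_c2_of_average_dead` — THE ORDER-2 COARSE DEAD ROW FROM THE ORDER-2 COVARIANCE ROW** (U21's `t2` :305 from its `c2` :313;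
root-generic site `ρ`, ANY `Q₁₀ Q₁₁ Q₁₂ D₂ D₁ W₁ W₂`, any fine index type `ν` and fine-residual type `ρ₁′`): if `c2` holds with a coarse image `D̄₂` that is,
ON THE COMB BONDS, tip-type with weight `κ·w̄² + V` (`w̄ = Q₁₀ h`), and the direction is average-comb-dead (`hdead`) and `V` is comb-dead, then
`τ₂ · (Q₁₂·[D₂ | D₁] + 2•(Q₁₁·W₁) + Q₁₀·W₂) = 0`.  The weight `κ` and the remainder `V` are whatever the order-2 covariance letter displays — NOT chosen here. -/
theorem torus_t2_of_c2_of_average_dead {τ₂ : Matrix (Res ρ Lc M') (↥(pbox M') × Fin (d + 1)) ℝ}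
    (hτ₂ : τ₂ = (combRowsT ρ Lc M').submatrix id (fun b : ↥(pbox M') × Fin (d + 1) => ((b.1, Sum.inl b.2) : Idx M' (Fib d))))
    {ν ρ₁' : Type*} [Fintype ν] (Q₁₀ Q₁₁ Q₁₂ : Matrix (↥(pbox M') × Fin (d + 1)) ν ℝ)
    (D₂ : Matrix ν (Res ρ Lc M') ℝ) (D₁ : Matrix ν ρ₁' ℝ) (W₁ W₂ : Matrix ν (Res ρ Lc M' ⊕ ρ₁') ℝ)
    (Db₂ : Matrix (↥(pbox M') × Fin (d + 1)) (Res ρ Lc M') ℝ)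
    (c2 : Q₁₂ * fromCols D₂ D₁ + (2 : ℝ) • (Q₁₁ * W₁) + Q₁₀ * W₂ = fromCols Db₂ (0 : Matrix (↥(pbox M') × Fin (d + 1)) ρ₁' ℝ))
    (h : ν → ℝ) (κ V : ↥(pbox M') × Fin (d + 1) → ℝ)
    (hDb₂ : ∀ (a : ↥(pbox M') × Fin (d + 1)) (x : Res ρ Lc M'), combBondT ρ Lc M' x = ((a.1, Sum.inl a.2) : Idx M' (Fib d)) →
      ∀ t : Res ρ Lc M', Db₂ a t = (κ a * (∑ b, Q₁₀ a b * h b) ^ 2 + V a) * tdelta M' ((a.1 : Site (d + 1)) + unitVec a.2) t.1)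
    (hdead : ∀ (a : ↥(pbox M') × Fin (d + 1)) (x : Res ρ Lc M'),
      combBondT ρ Lc M' x = ((a.1, Sum.inl a.2) : Idx M' (Fib d)) → ∑ b, Q₁₀ a b * h b = 0)
    (hV : ∀ (a : ↥(pbox M') × Fin (d + 1)) (x : Res ρ Lc M'), combBondT ρ Lc M' x = ((a.1, Sum.inl a.2) : Idx M' (Fib d)) → V a = 0) :
    τ₂ * (Q₁₂ * fromCols D₂ D₁ + (2 : ℝ) • (Q₁₁ * W₁) + Q₁₀ * W₂) = 0 :=
  t_of_covariance_letter τ₂ _ Db₂ c2 (torus_coarse_mul_Db2_eq_zero M' hτ₂ Q₁₀ h κ V Db₂ hDb₂ hdead hV)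

/-- [folklore] **`torus_t2_of_c2_sq` — THE SQUARE-LAW BRANCH (`κ₂ = 0`): `t2` FROM `hdead` ALONE.**  As `torus_t2_of_c2_of_average_dead` with the order-2
coarse image PURELY the square of the linear average on the comb (`D̄₂(a, t̄) = κ(a)·w̄(a)²·[t̄ = tip a]` there). -/
theorem torus_t2_of_c2_sq {τ₂ : Matrix (Res ρ Lc M') (↥(pbox M') × Fin (d + 1)) ℝ}
    (hτ₂ : τ₂ = (combRowsT ρ Lc M').submatrix id (fun b : ↥(pbox M') × Fin (d + 1) => ((b.1, Sum.inl b.2) : Idx M' (Fib d))))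
    {ν ρ₁' : Type*} [Fintype ν] (Q₁₀ Q₁₁ Q₁₂ : Matrix (↥(pbox M') × Fin (d + 1)) ν ℝ)
    (D₂ : Matrix ν (Res ρ Lc M') ℝ) (D₁ : Matrix ν ρ₁' ℝ) (W₁ W₂ : Matrix ν (Res ρ Lc M' ⊕ ρ₁') ℝ)
    (Db₂ : Matrix (↥(pbox M') × Fin (d + 1)) (Res ρ Lc M') ℝ)
    (c2 : Q₁₂ * fromCols D₂ D₁ + (2 : ℝ) • (Q₁₁ * W₁) + Q₁₀ * W₂ = fromCols Db₂ (0 : Matrix (↥(pbox M') × Fin (d + 1)) ρ₁' ℝ))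
    (h : ν → ℝ) (κ : ↥(pbox M') × Fin (d + 1) → ℝ)
    (hDb₂ : ∀ (a : ↥(pbox M') × Fin (d + 1)) (x : Res ρ Lc M'), combBondT ρ Lc M' x = ((a.1, Sum.inl a.2) : Idx M' (Fib d)) →
      ∀ t : Res ρ Lc M', Db₂ a t = κ a * (∑ b, Q₁₀ a b * h b) ^ 2 * tdelta M' ((a.1 : Site (d + 1)) + unitVec a.2) t.1)
    (hdead : ∀ (a : ↥(pbox M') × Fin (d + 1)) (x : Res ρ Lc M'),
      combBondT ρ Lc M' x = ((a.1, Sum.inl a.2) : Idx M' (Fib d)) → ∑ b, Q₁₀ a b * h b = 0) :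
    τ₂ * (Q₁₂ * fromCols D₂ D₁ + (2 : ℝ) • (Q₁₁ * W₁) + Q₁₀ * W₂) = 0 :=
  torus_t2_of_c2_of_average_dead M' hτ₂ Q₁₀ Q₁₁ Q₁₂ D₂ D₁ W₁ W₂ Db₂ c2 h κ (fun _ => 0)
    (fun a x hx t => by rw [hDb₂ a x hx t, add_zero]) hdead (fun _ _ _ => rfl)

end T2

/-! ## §3 The `κ₂ ≠ 0` branch is PRICED at the composite door: `uTop` under `hdead` is ONE scalar -/

section UTop

variable (M' : Fin (d + 1) → ℕ) {Lc : ℕ} [NeZero Lc] {r' : Fin (d + 1) → ℕ}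

/-- [folklore] the comb bond into a residual parameter `x` is a comb bond in the door's `hdead` spelling: `hdead` applies at
`a_x = (⟨baseOf x⟩, axisOf x)` (`TorusCombRows.combBondT_eq`). -/
theorem avg_eq_zero_at_combBond (hr' : r' ∈ box (d + 1) Lc) (hM' : ∀ i, Lc ∣ M' i)
    {ν : Type*} [Fintype ν] (Q₁₀ : Matrix (↥(pbox M') × Fin (d + 1)) ν ℝ) (h : ν → ℝ)
    (hdead : ∀ (a : ↥(pbox M') × Fin (d + 1)) (x : Res (toSite r') Lc M'),
      combBondT (toSite r') Lc M' x = ((a.1, Sum.inl a.2) : Idx M' (Fib d)) → (Q₁₀ *ᵥ h) a = 0)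
    (x : Res (toSite r') Lc M') :
    (Q₁₀ *ᵥ h) (⟨baseOf (toSite r') Lc x.site, baseOf_mem_pbox (Nat.pos_of_ne_zero (NeZero.ne Lc)) (toSite_mem_range hr') hM' x⟩,
        axisOf (toSite r') Lc x.site) = 0 :=
  hdead _ x (combBondT_eq (Nat.pos_of_ne_zero (NeZero.ne Lc)) (toSite_mem_range hr') hM' x)

/-- [folklore] **`torus_uTop_eq_sum_of_average_dead` — UNDER `hdead` THE TOP-CHART FADDEEV–POPOV 2-JET IS ONE SCALAR.**  At the composite door #21's types
(`τ₂ = combF Lc M′ r′`, `D̄ = σ • tgrad M′↾(fields × Res)` — #21's `hτ₂ hDbar` with `σ = σ_{n+1}`, `σ ≠ 0`) let the coarse images be, ON THE COMB BONDS,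
tip-type: `D̄₁(a, t̄) = −(c·(Q₁₀ *ᵥ h) a·[tip])` (leaf-02 C2 `torus_c1_tower`'s EXPLICIT `D̄₁` with `Q₁₀ := compRows …`, p314580's at `n = 0`; ANY `Q₁₀`,
any fine index type) and `D̄₂(a, t̄) = v(a)·[tip]` (ANY weight `v` — the detector's ∕ the order-2 letter's).  If the transported direction is
average-comb-dead (`hdead : (Q₁₀ *ᵥ h) a = 0` at every coarse comb bond), then `uTop`'s left side equals `Σ_{x : tip x = x} v(a_x) ∕ σ` — my g22
`CoarseFPDefect.torus_uTop_eq_sum` with the order-1 weight killed by `hdead` (`avg_eq_zero_at_combBond`).  So `uTop ⟺` that comb SUM vanishes —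
strictly weaker than `t2`'s entrywise `v(a_x) = 0`. -/
theorem torus_uTop_eq_sum_of_average_dead (hr' : r' ∈ box (d + 1) Lc) (hM' : ∀ i, Lc ∣ M' i)
    {τ₂ : Matrix (Res (toSite r') Lc M') (↥(pbox M') × Fin (d + 1)) ℝ} (hτ₂ : τ₂ = combF Lc M' r') {σ : ℝ} (hσ : σ ≠ 0)
    {Dbar : Matrix (↥(pbox M') × Fin (d + 1)) (Res (toSite r') Lc M') ℝ}
    (hDbar : Dbar = σ • (tgrad M').submatrix (fun a : ↥(pbox M') × Fin (d + 1) => ((a.1, Sum.inl a.2) : Idx M' (Fib d)))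
      (fun t : Res (toSite r') Lc M' => (t.1 : ↥(pbox M'))))
    (Db₁ Db₂ : Matrix (↥(pbox M') × Fin (d + 1)) (Res (toSite r') Lc M') ℝ)
    {ν : Type*} [Fintype ν] (Q₁₀ : Matrix (↥(pbox M') × Fin (d + 1)) ν ℝ) (h : ν → ℝ) (c : ℝ) (v : ↥(pbox M') × Fin (d + 1) → ℝ)
    (hDb₁ : ∀ a : ↥(pbox M') × Fin (d + 1), IsCombBondAt (toSite r') Lc a.2 (a.1 : Site (d + 1)) →
      ∀ t : Res (toSite r') Lc M', Db₁ a t = -(c * (Q₁₀ *ᵥ h) a * tdelta M' ((a.1 : Site (d + 1)) + unitVec a.2) t.1))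
    (hDb₂ : ∀ a : ↥(pbox M') × Fin (d + 1), IsCombBondAt (toSite r') Lc a.2 (a.1 : Site (d + 1)) →
      ∀ t : Res (toSite r') Lc M', Db₂ a t = v a * tdelta M' ((a.1 : Site (d + 1)) + unitVec a.2) t.1)
    (hdead : ∀ (a : ↥(pbox M') × Fin (d + 1)) (x : Res (toSite r') Lc M'),
      combBondT (toSite r') Lc M' x = ((a.1, Sum.inl a.2) : Idx M' (Fib d)) → (Q₁₀ *ᵥ h) a = 0) :
    secondVar (τ₂ * Dbar) (τ₂ * Db₁) (τ₂ * Db₂)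
      = ∑ x : Res (toSite r') Lc M', if tipOf (toSite r') Lc x.site = x.site then
          v (⟨baseOf (toSite r') Lc x.site, baseOf_mem_pbox (Nat.pos_of_ne_zero (NeZero.ne Lc)) (toSite_mem_range hr') hM' x⟩,
              axisOf (toSite r') Lc x.site) / σ
        else 0 := by
  rw [torus_uTop_eq_sum M' hr' hM' hτ₂ hσ hDbar Db₁ Db₂ (fun a => -(c * (Q₁₀ *ᵥ h) a)) v
    (fun a ha t => by rw [hDb₁ a ha t]; ring) hDb₂]
  refine Finset.sum_congr rfl fun x _ => ?_
  split_ifs with hx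
  · rw [avg_eq_zero_at_combBond M' hr' hM' Q₁₀ h hdead x, mul_zero, neg_zero]
    field_simp
    ring
  · rfl

/-- [folklore] **`uTop` UNDER `hdead` FROM THE VANISHING OF ONE COMB SUM** (the `κ₂ ≠ 0` branch's exact clause at #21's `uTop` slot; R-FP-56 (b)
«priced, not a dead line»). -/
theorem torus_uTop_of_average_dead_of_sum_eq_zero (hr' : r' ∈ box (d + 1) Lc) (hM' : ∀ i, Lc ∣ M' i)
    {τ₂ : Matrix (Res (toSite r') Lc M') (↥(pbox M') × Fin (d + 1)) ℝ} (hτ₂ : τ₂ = combF Lc M' r') {σ : ℝ} (hσ : σ ≠ 0)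
    {Dbar : Matrix (↥(pbox M') × Fin (d + 1)) (Res (toSite r') Lc M') ℝ}
    (hDbar : Dbar = σ • (tgrad M').submatrix (fun a : ↥(pbox M') × Fin (d + 1) => ((a.1, Sum.inl a.2) : Idx M' (Fib d)))
      (fun t : Res (toSite r') Lc M' => (t.1 : ↥(pbox M'))))
    (Db₁ Db₂ : Matrix (↥(pbox M') × Fin (d + 1)) (Res (toSite r') Lc M') ℝ)
    {ν : Type*} [Fintype ν] (Q₁₀ : Matrix (↥(pbox M') × Fin (d + 1)) ν ℝ) (h : ν → ℝ) (c : ℝ) (v : ↥(pbox M') × Fin (d + 1) → ℝ)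
    (hDb₁ : ∀ a : ↥(pbox M') × Fin (d + 1), IsCombBondAt (toSite r') Lc a.2 (a.1 : Site (d + 1)) →
      ∀ t : Res (toSite r') Lc M', Db₁ a t = -(c * (Q₁₀ *ᵥ h) a * tdelta M' ((a.1 : Site (d + 1)) + unitVec a.2) t.1))
    (hDb₂ : ∀ a : ↥(pbox M') × Fin (d + 1), IsCombBondAt (toSite r') Lc a.2 (a.1 : Site (d + 1)) →
      ∀ t : Res (toSite r') Lc M', Db₂ a t = v a * tdelta M' ((a.1 : Site (d + 1)) + unitVec a.2) t.1)
    (hdead : ∀ (a : ↥(pbox M') × Fin (d + 1)) (x : Res (toSite r') Lc M'),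
      combBondT (toSite r') Lc M' x = ((a.1, Sum.inl a.2) : Idx M' (Fib d)) → (Q₁₀ *ᵥ h) a = 0)
    (hsum : ∑ x : Res (toSite r') Lc M', (if tipOf (toSite r') Lc x.site = x.site then
          v (⟨baseOf (toSite r') Lc x.site, baseOf_mem_pbox (Nat.pos_of_ne_zero (NeZero.ne Lc)) (toSite_mem_range hr') hM' x⟩,
              axisOf (toSite r') Lc x.site)
        else 0) = 0) :
    secondVar (τ₂ * Dbar) (τ₂ * Db₁) (τ₂ * Db₂) = 0 := by
  rw [torus_uTop_eq_sum_of_average_dead M' hr' hM' hτ₂ hσ hDbar Db₁ Db₂ Q₁₀ h c v hDb₁ hDb₂ hdead]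
  have e : ∑ x : Res (toSite r') Lc M', (if tipOf (toSite r') Lc x.site = x.site then
          v (⟨baseOf (toSite r') Lc x.site, baseOf_mem_pbox (Nat.pos_of_ne_zero (NeZero.ne Lc)) (toSite_mem_range hr') hM' x⟩,
              axisOf (toSite r') Lc x.site) / σ
        else 0)
      = (∑ x : Res (toSite r') Lc M', (if tipOf (toSite r') Lc x.site = x.site then
          v (⟨baseOf (toSite r') Lc x.site, baseOf_mem_pbox (Nat.pos_of_ne_zero (NeZero.ne Lc)) (toSite_mem_range hr') hM' x⟩,
              axisOf (toSite r') Lc x.site)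
        else 0)) / σ := by
    rw [Finset.sum_div]
    exact Finset.sum_congr rfl fun x _ => by split_ifs <;> simp
  rw [e, hsum, zero_div]

/-- [folklore] **IN PARTICULAR `uTop ⟸ hdead ∧ (v comb-dead)`** — the entrywise (`t2`-strength) vanishing of the order-2 weight on the comb suffices (the
square law `v = κ·((Q₁₀ *ᵥ h) a)²` is such a case: `torus_uTop_of_average_dead_sq`). -/
theorem torus_uTop_of_average_dead_of_dead (hr' : r' ∈ box (d + 1) Lc) (hM' : ∀ i, Lc ∣ M' i)
    {τ₂ : Matrix (Res (toSite r') Lc M') (↥(pbox M') × Fin (d + 1)) ℝ} (hτ₂ : τ₂ = combF Lc M' r') {σ : ℝ} (hσ : σ ≠ 0)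
    {Dbar : Matrix (↥(pbox M') × Fin (d + 1)) (Res (toSite r') Lc M') ℝ}
    (hDbar : Dbar = σ • (tgrad M').submatrix (fun a : ↥(pbox M') × Fin (d + 1) => ((a.1, Sum.inl a.2) : Idx M' (Fib d)))
      (fun t : Res (toSite r') Lc M' => (t.1 : ↥(pbox M'))))
    (Db₁ Db₂ : Matrix (↥(pbox M') × Fin (d + 1)) (Res (toSite r') Lc M') ℝ)
    {ν : Type*} [Fintype ν] (Q₁₀ : Matrix (↥(pbox M') × Fin (d + 1)) ν ℝ) (h : ν → ℝ) (c : ℝ) (v : ↥(pbox M') × Fin (d + 1) → ℝ)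
    (hDb₁ : ∀ a : ↥(pbox M') × Fin (d + 1), IsCombBondAt (toSite r') Lc a.2 (a.1 : Site (d + 1)) →
      ∀ t : Res (toSite r') Lc M', Db₁ a t = -(c * (Q₁₀ *ᵥ h) a * tdelta M' ((a.1 : Site (d + 1)) + unitVec a.2) t.1))
    (hDb₂ : ∀ a : ↥(pbox M') × Fin (d + 1), IsCombBondAt (toSite r') Lc a.2 (a.1 : Site (d + 1)) →
      ∀ t : Res (toSite r') Lc M', Db₂ a t = v a * tdelta M' ((a.1 : Site (d + 1)) + unitVec a.2) t.1)
    (hdead : ∀ (a : ↥(pbox M') × Fin (d + 1)) (x : Res (toSite r') Lc M'),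
      combBondT (toSite r') Lc M' x = ((a.1, Sum.inl a.2) : Idx M' (Fib d)) → (Q₁₀ *ᵥ h) a = 0)
    (hv : ∀ (a : ↥(pbox M') × Fin (d + 1)) (x : Res (toSite r') Lc M'),
      combBondT (toSite r') Lc M' x = ((a.1, Sum.inl a.2) : Idx M' (Fib d)) → v a = 0) :
    secondVar (τ₂ * Dbar) (τ₂ * Db₁) (τ₂ * Db₂) = 0 :=
  torus_uTop_of_average_dead_of_sum_eq_zero M' hr' hM' hτ₂ hσ hDbar Db₁ Db₂ Q₁₀ h c v hDb₁ hDb₂ hdead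
    (Finset.sum_eq_zero fun x _ => by
      split_ifs
      · exact hv _ x (combBondT_eq (Nat.pos_of_ne_zero (NeZero.ne Lc)) (toSite_mem_range hr') hM' x)
      · rfl)

/-- [folklore] **THE SQUARE-LAW BRANCH AT `uTop`**: if ON THE COMB `D̄₂(a, t̄) = κ(a)·((Q₁₀ *ᵥ h) a)²·[tip]`, then `uTop ⟸ hdead` alone. -/
theorem torus_uTop_of_average_dead_sq (hr' : r' ∈ box (d + 1) Lc) (hM' : ∀ i, Lc ∣ M' i)
    {τ₂ : Matrix (Res (toSite r') Lc M') (↥(pbox M') × Fin (d + 1)) ℝ} (hτ₂ : τ₂ = combF Lc M' r') {σ : ℝ} (hσ : σ ≠ 0)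
    {Dbar : Matrix (↥(pbox M') × Fin (d + 1)) (Res (toSite r') Lc M') ℝ}
    (hDbar : Dbar = σ • (tgrad M').submatrix (fun a : ↥(pbox M') × Fin (d + 1) => ((a.1, Sum.inl a.2) : Idx M' (Fib d)))
      (fun t : Res (toSite r') Lc M' => (t.1 : ↥(pbox M'))))
    (Db₁ Db₂ : Matrix (↥(pbox M') × Fin (d + 1)) (Res (toSite r') Lc M') ℝ)
    {ν : Type*} [Fintype ν] (Q₁₀ : Matrix (↥(pbox M') × Fin (d + 1)) ν ℝ) (h : ν → ℝ) (c : ℝ) (κ : ↥(pbox M') × Fin (d + 1) → ℝ)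
    (hDb₁ : ∀ a : ↥(pbox M') × Fin (d + 1), IsCombBondAt (toSite r') Lc a.2 (a.1 : Site (d + 1)) →
      ∀ t : Res (toSite r') Lc M', Db₁ a t = -(c * (Q₁₀ *ᵥ h) a * tdelta M' ((a.1 : Site (d + 1)) + unitVec a.2) t.1))
    (hDb₂ : ∀ a : ↥(pbox M') × Fin (d + 1), IsCombBondAt (toSite r') Lc a.2 (a.1 : Site (d + 1)) →
      ∀ t : Res (toSite r') Lc M', Db₂ a t = κ a * (Q₁₀ *ᵥ h) a ^ 2 * tdelta M' ((a.1 : Site (d + 1)) + unitVec a.2) t.1)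
    (hdead : ∀ (a : ↥(pbox M') × Fin (d + 1)) (x : Res (toSite r') Lc M'),
      combBondT (toSite r') Lc M' x = ((a.1, Sum.inl a.2) : Idx M' (Fib d)) → (Q₁₀ *ᵥ h) a = 0) :
    secondVar (τ₂ * Dbar) (τ₂ * Db₁) (τ₂ * Db₂) = 0 :=
  torus_uTop_of_average_dead_of_dead M' hr' hM' hτ₂ hσ hDbar Db₁ Db₂ Q₁₀ h c (fun a => κ a * (Q₁₀ *ᵥ h) a ^ 2) hDb₁ hDb₂ hdead
    (fun a x hx => by rw [hdead a x hx]; ring)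

end UTop

/-! ## §4 The same at the NESTED Faddeev–Popov 2-jet socket `uT` (my g21 `NestedFPSplit` + g22 `torus_uT_of_*`'s shape) -/

section UT

variable (M' : Fin (d + 1) → ℕ) [∀ μ, NeZero (M' μ)] {Lc : ℕ} [NeZero Lc] {r' : Fin (d + 1) → ℕ}

/-- [folklore] **`torus_uT_of_average_dead_of_sum_eq_zero` — THE NESTED FADDEEV–POPOV 2-JET VANISHES UNDER `c0 c1 c2`, THE FINE BLOCK's `uLow`, `hdead`
AND THE ONE COMB SUM** (`CoarseFPExponential.torus_uT_of_dead`'s statement with its two dead-jet hypotheses `hDb₁ hDb₂` REPLACED by the displayed shapes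
`D̄₁ = −(c·(Q₁₀ *ᵥ h) a·[tip])`, `D̄₂ = v·[tip]` on the comb + `hdead` + `Σ_{comb x, tip} v(a_x) = 0`): `NestedFPSplit.secondVar_nestedFP_eq_zero_of_blocks`
(block lower-triangular under `c0 c1 c2`; coarse block non-degenerate by g21 `det_combF_mul_smul_tgrad_res_ne_zero`) fed with §3.  This is the m = 1 door's
`uT` route (the (uLow, uTop) presentation of #21) for the `κ₂ ≠ 0` branch — typed, NOT chosen (Q-leaf06-g24-1). -/
theorem torus_uT_of_average_dead_of_sum_eq_zero (hr' : r' ∈ box (d + 1) Lc) (hM' : ∀ i, Lc ∣ M' i)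
    {τ₂ : Matrix (Res (toSite r') Lc M') (↥(pbox M') × Fin (d + 1)) ℝ} (hτ₂ : τ₂ = combF Lc M' r') {σ : ℝ} (hσ : σ ≠ 0)
    {Dbar : Matrix (↥(pbox M') × Fin (d + 1)) (Res (toSite r') Lc M') ℝ}
    (hDbar : Dbar = σ • (tgrad M').submatrix (fun a : ↥(pbox M') × Fin (d + 1) => ((a.1, Sum.inl a.2) : Idx M' (Fib d)))
      (fun t : Res (toSite r') Lc M' => (t.1 : ↥(pbox M'))))
    {ν ρ₁ : Type*} [Fintype ν] [Fintype ρ₁] [DecidableEq ρ₁] (τ₁ : Matrix ρ₁ ν ℝ)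
    (Q₁₀ Q₁₁ Q₁₂ : Matrix (↥(pbox M') × Fin (d + 1)) ν ℝ) (W₀ W₁ W₂ : Matrix ν (Res (toSite r') Lc M' ⊕ ρ₁) ℝ)
    (Db₁ Db₂ : Matrix (↥(pbox M') × Fin (d + 1)) (Res (toSite r') Lc M') ℝ) (h : ν → ℝ) (c : ℝ) (v : ↥(pbox M') × Fin (d + 1) → ℝ)
    (hDb₁ : ∀ a : ↥(pbox M') × Fin (d + 1), IsCombBondAt (toSite r') Lc a.2 (a.1 : Site (d + 1)) →
      ∀ t : Res (toSite r') Lc M', Db₁ a t = -(c * (Q₁₀ *ᵥ h) a * tdelta M' ((a.1 : Site (d + 1)) + unitVec a.2) t.1))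
    (hDb₂ : ∀ a : ↥(pbox M') × Fin (d + 1), IsCombBondAt (toSite r') Lc a.2 (a.1 : Site (d + 1)) →
      ∀ t : Res (toSite r') Lc M', Db₂ a t = v a * tdelta M' ((a.1 : Site (d + 1)) + unitVec a.2) t.1)
    (hdead : ∀ (a : ↥(pbox M') × Fin (d + 1)) (x : Res (toSite r') Lc M'),
      combBondT (toSite r') Lc M' x = ((a.1, Sum.inl a.2) : Idx M' (Fib d)) → (Q₁₀ *ᵥ h) a = 0)
    (hsum : ∑ x : Res (toSite r') Lc M', (if tipOf (toSite r') Lc x.site = x.site then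
          v (⟨baseOf (toSite r') Lc x.site, baseOf_mem_pbox (Nat.pos_of_ne_zero (NeZero.ne Lc)) (toSite_mem_range hr') hM' x⟩,
              axisOf (toSite r') Lc x.site)
        else 0) = 0)
    (c0 : Q₁₀ * W₀ = Matrix.fromCols Dbar (0 : Matrix (↥(pbox M') × Fin (d + 1)) ρ₁ ℝ))
    (c1 : Q₁₁ * W₀ + Q₁₀ * W₁ = Matrix.fromCols Db₁ (0 : Matrix (↥(pbox M') × Fin (d + 1)) ρ₁ ℝ))
    (c2 : Q₁₂ * W₀ + (2 : ℝ) • (Q₁₁ * W₁) + Q₁₀ * W₂ = Matrix.fromCols Db₂ (0 : Matrix (↥(pbox M') × Fin (d + 1)) ρ₁ ℝ))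
    (hlow : (τ₁ * W₀.toCols₂).det ≠ 0) (uLow : secondVar (τ₁ * W₀.toCols₂) (τ₁ * W₁.toCols₂) (τ₁ * W₂.toCols₂) = 0) :
    secondVar (Matrix.fromRows (τ₂ * Q₁₀) τ₁ * W₀) (Matrix.fromRows (τ₂ * Q₁₁) (0 : Matrix ρ₁ ν ℝ) * W₀ + Matrix.fromRows (τ₂ * Q₁₀) τ₁ * W₁)
        (Matrix.fromRows (τ₂ * Q₁₂) (0 : Matrix ρ₁ ν ℝ) * W₀ + Matrix.fromRows (τ₂ * Q₁₁) (0 : Matrix ρ₁ ν ℝ) * W₁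
          + (Matrix.fromRows (τ₂ * Q₁₁) (0 : Matrix ρ₁ ν ℝ) * W₁ + Matrix.fromRows (τ₂ * Q₁₀) τ₁ * W₂)) = 0 :=
  secondVar_nestedFP_eq_zero_of_blocks τ₁ τ₂ Q₁₀ Q₁₁ Q₁₂ W₀ W₁ W₂ Dbar Db₁ Db₂ c0 c1 c2
    (by rw [hτ₂, hDbar]; exact det_combF_mul_smul_tgrad_res_ne_zero Lc M' hr' hM' hσ) hlow
    (torus_uTop_of_average_dead_of_sum_eq_zero M' hr' hM' hτ₂ hσ hDbar Db₁ Db₂ Q₁₀ h c v hDb₁ hDb₂ hdead hsum) uLow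

end UT

/-! ## §5 (v1.2 append, 2026-08-23) The C2-DET shape: `D̄₂ = κ·((Q₁₀ *ᵥ h) a)²·[tip]` — `t2` from `hdead` in U21's `Σ` spelling -/

section C2Det

variable (M' : Fin (d + 1) → ℕ) {Lc : ℕ} {ρ : Site (d + 1)}

/-- [folklore] **`torus_t2_of_c2_sq_mulVec` — THE SQUARE LAW IN THE `*ᵥ` SPELLING.**  Engine C's C2-DET (leaf-02 g23 [D1LEAF02-G23-C2DET-RECEIPT], journal
l.48544; kernel side: leaf-02's `SymBorderGaugeLegContactTwo`, INTENT 13) reports U21's order-2 coarse jet as `D̄₂(a, t̄) = c₀³·((Q₁₀ *ᵥ h) a)²·[t̄ = a.1 + e_{a.2}]`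
— tip-type, a PURE SQUARE of the direction's linear average (`κ₂ = 0`).  This is `torus_t2_of_c2_sq` with the shape row spelled through `Q₁₀ *ᵥ h` (the
spelling of the detector ∕ of leaf-02 C2's `D̄₁`) while `hdead` stays in U21's `Σ_b Q₁₀ a b·h b` spelling (#29): `t2 ⟸ c2 + hdead`, ANY weight `κ` (so
`κ := fun _ => c₀ ^ 3`, or whatever sign∕normalisation the torus face (T) displays, is one `fun _ => …`).  The shape is DISPLAYED, not asserted: `c2` with this
`D̄₂` is leaf-02's torus face (T), pending. -/
theorem torus_t2_of_c2_sq_mulVec {τ₂ : Matrix (Res ρ Lc M') (↥(pbox M') × Fin (d + 1)) ℝ}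
    (hτ₂ : τ₂ = (combRowsT ρ Lc M').submatrix id (fun b : ↥(pbox M') × Fin (d + 1) => ((b.1, Sum.inl b.2) : Idx M' (Fib d))))
    {ν ρ₁' : Type*} [Fintype ν] (Q₁₀ Q₁₁ Q₁₂ : Matrix (↥(pbox M') × Fin (d + 1)) ν ℝ)
    (D₂ : Matrix ν (Res ρ Lc M') ℝ) (D₁ : Matrix ν ρ₁' ℝ) (W₁ W₂ : Matrix ν (Res ρ Lc M' ⊕ ρ₁') ℝ)
    (Db₂ : Matrix (↥(pbox M') × Fin (d + 1)) (Res ρ Lc M') ℝ)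
    (c2 : Q₁₂ * fromCols D₂ D₁ + (2 : ℝ) • (Q₁₁ * W₁) + Q₁₀ * W₂ = fromCols Db₂ (0 : Matrix (↥(pbox M') × Fin (d + 1)) ρ₁' ℝ))
    (h : ν → ℝ) (κ : ↥(pbox M') × Fin (d + 1) → ℝ)
    (hDb₂ : ∀ (a : ↥(pbox M') × Fin (d + 1)) (x : Res ρ Lc M'), combBondT ρ Lc M' x = ((a.1, Sum.inl a.2) : Idx M' (Fib d)) →
      ∀ t : Res ρ Lc M', Db₂ a t = κ a * (Q₁₀ *ᵥ h) a ^ 2 * tdelta M' ((a.1 : Site (d + 1)) + unitVec a.2) t.1)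
    (hdead : ∀ (a : ↥(pbox M') × Fin (d + 1)) (x : Res ρ Lc M'),
      combBondT ρ Lc M' x = ((a.1, Sum.inl a.2) : Idx M' (Fib d)) → ∑ b, Q₁₀ a b * h b = 0) :
    τ₂ * (Q₁₂ * fromCols D₂ D₁ + (2 : ℝ) • (Q₁₁ * W₁) + Q₁₀ * W₂) = 0 :=
  torus_t2_of_c2_sq M' hτ₂ Q₁₀ Q₁₁ Q₁₂ D₂ D₁ W₁ W₂ Db₂ c2 h κ
    (fun a x hx t => by rw [hDb₂ a x hx t]; rfl) hdead

/-- [folklore] **THE SAME WITH `hdead` IN THE `*ᵥ` SPELLING TOO** (P2 `NestedColumnCombDeadTower.hdead_of_nested_column_mulVec`'s output shape). -/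
theorem torus_t2_of_c2_sq_mulVec' {τ₂ : Matrix (Res ρ Lc M') (↥(pbox M') × Fin (d + 1)) ℝ}
    (hτ₂ : τ₂ = (combRowsT ρ Lc M').submatrix id (fun b : ↥(pbox M') × Fin (d + 1) => ((b.1, Sum.inl b.2) : Idx M' (Fib d))))
    {ν ρ₁' : Type*} [Fintype ν] (Q₁₀ Q₁₁ Q₁₂ : Matrix (↥(pbox M') × Fin (d + 1)) ν ℝ)
    (D₂ : Matrix ν (Res ρ Lc M') ℝ) (D₁ : Matrix ν ρ₁' ℝ) (W₁ W₂ : Matrix ν (Res ρ Lc M' ⊕ ρ₁') ℝ)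
    (Db₂ : Matrix (↥(pbox M') × Fin (d + 1)) (Res ρ Lc M') ℝ)
    (c2 : Q₁₂ * fromCols D₂ D₁ + (2 : ℝ) • (Q₁₁ * W₁) + Q₁₀ * W₂ = fromCols Db₂ (0 : Matrix (↥(pbox M') × Fin (d + 1)) ρ₁' ℝ))
    (h : ν → ℝ) (κ : ↥(pbox M') × Fin (d + 1) → ℝ)
    (hDb₂ : ∀ (a : ↥(pbox M') × Fin (d + 1)) (x : Res ρ Lc M'), combBondT ρ Lc M' x = ((a.1, Sum.inl a.2) : Idx M' (Fib d)) →
      ∀ t : Res ρ Lc M', Db₂ a t = κ a * (Q₁₀ *ᵥ h) a ^ 2 * tdelta M' ((a.1 : Site (d + 1)) + unitVec a.2) t.1)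
    (hdead : ∀ (a : ↥(pbox M') × Fin (d + 1)) (x : Res ρ Lc M'),
      combBondT ρ Lc M' x = ((a.1, Sum.inl a.2) : Idx M' (Fib d)) → (Q₁₀ *ᵥ h) a = 0) :
    τ₂ * (Q₁₂ * fromCols D₂ D₁ + (2 : ℝ) • (Q₁₁ * W₁) + Q₁₀ * W₂) = 0 :=
  torus_t2_of_c2_sq_mulVec M' hτ₂ Q₁₀ Q₁₁ Q₁₂ D₂ D₁ W₁ W₂ Db₂ c2 h κ hDb₂
    (fun a x hx => by have e := hdead a x hx; rwa [mulVec, dotProduct] at e)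

end C2Det

end Summit.QuantumFields.BalabanUV.Beta.FP.NestedDeadRowsOrderTwo

end
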